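import Summits.BirchSwinnertonDyer.BirchSwinnertonDyer.Theorems.QuadraticBranchSignedControlEtaTransportPlusOfDecomposition
import Summits.BirchSwinnertonDyer.BirchSwinnertonDyer.Theses.QuadraticBranchSignedControl
import Literature.NumberTheory.EllipticCurves.Kobayashi2003.SignedSelmerEtaComponentFacts
import HarnessLib

/-!
# Route `QuadraticBranchSignedControl` (rung K8, cell `bsd-potss`), crux `EtaTransportSigned`
# (item stmt-BirchSwinnertonDyer-19115): the crux = its PLUS stub + ONE NAMED Literature fact
# (Kobayashi 2003 Thm. 7.4 at `η`); hence the crux MODULO the decomposition frame `hdec` and that fact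

WHAT. Supersedes the displayed frame `h74` of this seat's
`…EtaTransportMinusOfPlus.lean` (p418188) by the NAMED fact
`Literature.NumberTheory.EllipticCurves.Kobayashi2003.thm74_etaEvenMC_iff_etaOddMC` (cell `bsd-cm`'s
typer, landed 2026-08-26; Kobayashi 2003 Thm. 7.4 read at the quadratic character `η`, on the
LITERATURE promotion copy `Kobayashi2003.EtaSignedSelmerDualData` of cc-typer-6's `η`-object — a
structure with the same fields over definitionally equal tower objects, so a Summits datum IS a
Literature datum field for field, and conversely), and drops Mazur's `p ∤ c₀` (the fact quantifies
the plus side over ALL plus branch functions, so no plus function has to be exhibited):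
* `etaTransportMinus_of_plus_of_thm74Fact` — the minus conjunct of `EtaTransportSigned` (registered
  stub `stub_etaMC_minus`, verbatim) from the plus conjunct (`stub_etaMC_plus`) and the named fact;
* `etaTransportSigned_of_plus_of_thm74Fact` — **the crux `EtaTransportSigned` BY NAME from its plus
  stub and the named fact**;
* `etaTransportSigned_of_decomposition_of_thm74Fact` — the crux from the decomposition frame `hdec`
  of `etaTransportPlus_of_decomposition` (p418003; = ctrl's piece (i), itself reduced to the two
  comparison frames (A)/(i-f) by `…EtaTransportDecompositionOfFrames.lean`) and the named fact.
So the crux's trust base is: (C1_η) (hypothesis position, by design) + the Γ-equivariant descent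
`Sel⁺(V'/F_∞) ≃ Sel⁺(V/ℚ_∞) ⊕ Sel⁺(V/K_∞)^η` (frame, WANTED) + Kobayashi Thm. 7.4 (ii)⟹(iii) at `η`
(named fact, no `_holds`: Coleman maps + Kato's Euler system).

HONEST FRAMING (cell `bsd-potss`, run/shared/lean/pub/bsd-potss/; FULL-BSD rank ≤ 1 programme):
TOOL THEOREMS ONLY — no definition, no named fact minted, no `sorry`, axioms standard. CONDITIONAL
(`conditional-result`): the named fact `thm74_etaEvenMC_iff_etaOddMC` and the displayed frame
`hdec`; the item is NOT closed; nothing is booked; `BSD(W, p)` is claimed for no pair; BSD is not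
proved by any of this. Seat `bsd-potss-k8q-c3` (prover), g0.

References: [Kobayashi2003] Thm. 7.4 and its proof (p. 13), §4 (p. 8), Def. 2.1 (p. 5), §3 (p. 5).
-/

set_option autoImplicit false
set_option linter.dupNamespace false

noncomputable section

open scoped Classical MatrixGroups ModularForm

open CongruenceSubgroup Field WeierstrassCurve
open Literature.NumberTheory.EllipticCurves
open Literature.NumberTheory.EllipticCurves.ModularForms
open Literature.NumberTheory.GaloisRepresentations
open Summit.BirchSwinnertonDyer.Rank1Residual.Additive
open Summit.BirchSwinnertonDyer.BirchSwinnertonDyer.Theses.QuadraticBranchSignedControl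

namespace Summit.BirchSwinnertonDyer.BirchSwinnertonDyer.Theorems

/-- **Stub `stub_etaMC_minus` = stub `stub_etaMC_plus` + Kobayashi's Thm. 7.4 at `η` (NAMED fact).**
The statement after the two hypotheses is the registered stub signature `Sig.stub_etaMC_minus`
verbatim (= the second conjunct of
`Summit.BirchSwinnertonDyer.BirchSwinnertonDyer.Theses.QuadraticBranchSignedControl.EtaTransportSigned`);
`hplus` is the first conjunct verbatim. Proof: for the given `(p, K₀, ηq, V, f, ϖ, κ, γ)` the plus
conjunct gives the even main conjecture at `η` for EVERY plus branch function and every plus datum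
— read on the Literature copy of the `η`-object field for field (same module `X`, same
`charIdeal`) — and the named fact `thm74_etaEvenMC_iff_etaOddMC` (even ⟺ odd at `η`) turns it into
the odd statement for the given minus function and datum. CONDITIONAL on the named fact.
[cite: Kobayashi2003, Thm. 7.4 and its proof (p. 13); §4 p. 8] -/
theorem etaTransportMinus_of_plus_of_thm74Fact
    (h74 : Kobayashi2003.thm74_etaEvenMC_iff_etaOddMC)
    (hplus : ∀ (p : ℕ) [Fact p.Prime], 5 ≤ p →
      ∀ (K₀ : Type) [Field K₀] [NumberField K₀] [IsCyclotomicExtension {p} ℚ K₀]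
        [(galRange (K := ℚ) K₀).Normal] (ηq : absoluteGaloisGroup ℚ →* ℤˣ),
        (∀ σ ∈ galRange (K := ℚ) K₀, ηq σ = 1) → ηq ≠ 1 →
      ∀ (V : WeierstrassCurve ℚ) [V.IsElliptic] [V.IsGloballyMinimal] {N : ℕ} [NeZero N]
        {f : CuspForm (Gamma0 N) 2},
        p ≠ 2 → V.HasGoodReductionAtPrime p → V.frobeniusTrace p = 0 →
        QuadraticBranchPlusMainConjectureAt V p → IsNewformOf V f →
      ∀ (ϖ : ℚ), (if Even (p / 2) then (ϖ : ℝ) * V.realPeriodRat = plusPeriod f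
          else (ϖ : ℝ) * V.imaginaryPeriodRat = minusPeriod f) →
      ∀ (Lη : IwasawaAlgebra p), IsQuadraticBranchPlusLFunction f p ϖ Lη →
      ∀ (κ : ZpExtension ℚ p) (γ : absoluteGaloisGroup ℚ),
        κ.IsCyclotomic → κ.IsTopGenerator γ → γ ∈ galRange (K := ℚ) K₀ →
        IsCyclotomicVariable p γ →
      ∀ (D : EtaSignedSelmerDualData V κ K₀ ℚ_[p] ηq γ 1),
        Module.Finite (IwasawaAlgebra p) D.X ∧ Module.IsTorsion (IwasawaAlgebra p) D.X ∧
          D.charIdeal = Ideal.span {Lη}) :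
    ∀ (p : ℕ) [Fact p.Prime], 5 ≤ p →
    ∀ (K₀ : Type) [Field K₀] [NumberField K₀] [IsCyclotomicExtension {p} ℚ K₀]
      [(galRange (K := ℚ) K₀).Normal] (ηq : absoluteGaloisGroup ℚ →* ℤˣ),
      (∀ σ ∈ galRange (K := ℚ) K₀, ηq σ = 1) → ηq ≠ 1 →
    ∀ (V : WeierstrassCurve ℚ) [V.IsElliptic] [V.IsGloballyMinimal] {N : ℕ} [NeZero N]
      {f : CuspForm (Gamma0 N) 2},
      p ≠ 2 → V.HasGoodReductionAtPrime p → V.frobeniusTrace p = 0 →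
      QuadraticBranchPlusMainConjectureAt V p → IsNewformOf V f →
    ∀ (ϖ : ℚ), (if Even (p / 2) then (ϖ : ℝ) * V.realPeriodRat = plusPeriod f
        else (ϖ : ℝ) * V.imaginaryPeriodRat = minusPeriod f) →
    ∀ (Lη : IwasawaAlgebra p), IsQuadraticBranchMinusLFunction f p ϖ Lη →
    ∀ (κ : ZpExtension ℚ p) (γ : absoluteGaloisGroup ℚ),
      κ.IsCyclotomic → κ.IsTopGenerator γ → γ ∈ galRange (K := ℚ) K₀ →
      IsCyclotomicVariable p γ →
    ∀ (D : EtaSignedSelmerDualData V κ K₀ ℚ_[p] ηq γ (-1)) (L' : IwasawaAlgebra p),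
      Lη = PowerSeries.X * L' → D.charIdeal = Ideal.span {L'} := by
  intro p _ hp5 K₀ _ _ _ _ ηq hηK hη1 V _ _ N _ f hp2 hgood hap h1 hf ϖ hϖ Lη hL κ γ hκ hγ hγK hγc D L'
    hLL'
  -- the even main conjecture at `η`, for every plus function and every (Literature-copy) plus datum
  have heven : ∀ (Lp : IwasawaAlgebra p), Kobayashi2003.IsQuadraticBranchPlusLFunction f p ϖ Lp →
      ∀ D' : Kobayashi2003.EtaSignedSelmerDualData V κ K₀ ℚ_[p] ηq γ 1,
        D'.charIdeal = Ideal.span {Lp} := by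
    intro Lp hLp D'
    let Dp : EtaSignedSelmerDualData V κ K₀ ℚ_[p] ηq γ 1 :=
      { X := D'.X
        conj_mem := D'.conj_mem
        toDual := D'.toDual
        bijective := D'.bijective
        toDual_T_smul := D'.toDual_T_smul
        toDual_C_smul := D'.toDual_C_smul }
    exact (hplus p hp5 K₀ ηq hηK hη1 V hp2 hgood hap h1 hf ϖ hϖ Lp hLp κ γ hκ hγ hγK hγc Dp).2.2
  -- Thm. 7.4 at `η`: even ⟹ odd, read back on the Summits datum `D`
  let D' : Kobayashi2003.EtaSignedSelmerDualData V κ K₀ ℚ_[p] ηq γ (-1) :=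
    { X := D.X
      conj_mem := D.conj_mem
      toDual := D.toDual
      bijective := D.bijective
      toDual_T_smul := D.toDual_T_smul
      toDual_C_smul := D.toDual_C_smul }
  exact (h74 p K₀ ηq hηK hη1 V hp2 hgood hap hf ϖ hϖ κ γ hκ hγ hγK hγc).mp heven Lη hL D' L' hLL'

/-- **The crux `EtaTransportSigned` BY NAME from its plus stub and Kobayashi's Thm. 7.4 at `η`
(NAMED fact).** `EtaTransportSigned = stub_etaMC_plus ∧ stub_etaMC_minus` and the minus stub is
`etaTransportMinus_of_plus_of_thm74Fact`. CONDITIONAL on `hplus` (the plus stub: (C1_η)-antecedent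
form of the even main conjecture at `η`; = ctrl's piece (i), open) and on the named fact.
[cite: Kobayashi2003, Thm. 7.4 (p. 13), §4 p. 8] -/
theorem etaTransportSigned_of_plus_of_thm74Fact
    (h74 : Kobayashi2003.thm74_etaEvenMC_iff_etaOddMC)
    (hplus : ∀ (p : ℕ) [Fact p.Prime], 5 ≤ p →
      ∀ (K₀ : Type) [Field K₀] [NumberField K₀] [IsCyclotomicExtension {p} ℚ K₀]
        [(galRange (K := ℚ) K₀).Normal] (ηq : absoluteGaloisGroup ℚ →* ℤˣ),
        (∀ σ ∈ galRange (K := ℚ) K₀, ηq σ = 1) → ηq ≠ 1 →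
      ∀ (V : WeierstrassCurve ℚ) [V.IsElliptic] [V.IsGloballyMinimal] {N : ℕ} [NeZero N]
        {f : CuspForm (Gamma0 N) 2},
        p ≠ 2 → V.HasGoodReductionAtPrime p → V.frobeniusTrace p = 0 →
        QuadraticBranchPlusMainConjectureAt V p → IsNewformOf V f →
      ∀ (ϖ : ℚ), (if Even (p / 2) then (ϖ : ℝ) * V.realPeriodRat = plusPeriod f
          else (ϖ : ℝ) * V.imaginaryPeriodRat = minusPeriod f) →
      ∀ (Lη : IwasawaAlgebra p), IsQuadraticBranchPlusLFunction f p ϖ Lη →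
      ∀ (κ : ZpExtension ℚ p) (γ : absoluteGaloisGroup ℚ),
        κ.IsCyclotomic → κ.IsTopGenerator γ → γ ∈ galRange (K := ℚ) K₀ →
        IsCyclotomicVariable p γ →
      ∀ (D : EtaSignedSelmerDualData V κ K₀ ℚ_[p] ηq γ 1),
        Module.Finite (IwasawaAlgebra p) D.X ∧ Module.IsTorsion (IwasawaAlgebra p) D.X ∧
          D.charIdeal = Ideal.span {Lη}) :
    EtaTransportSigned :=
  ⟨hplus, etaTransportMinus_of_plus_of_thm74Fact h74 hplus⟩

/-- **The crux `EtaTransportSigned` BY NAME from the decomposition frame `hdec` and Kobayashi's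
Thm. 7.4 at `η` (NAMED fact)**: the plus stub is `etaTransportPlus_of_decomposition hdec`
(p418003). CONDITIONAL on the displayed frame `hdec` (Γ-equivariant descent
`Sel⁺(V'/F_∞) ≃ Sel⁺(V/ℚ_∞) ⊕ Sel⁺(V/K₀ℚ_∞)^η`; WANTED, = ctrl's piece (i)) and on the named fact;
closes nothing. [cite: Kobayashi2003, §4 p. 8 and Thm. 7.4 (p. 13)] [cite: GreenbergLNM1716, §3] -/
theorem etaTransportSigned_of_decomposition_of_thm74Fact
    (hdec : ∀ (p : ℕ) [Fact p.Prime], 5 ≤ p →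
      ∀ (K₀ : Type) [Field K₀] [NumberField K₀] [IsCyclotomicExtension {p} ℚ K₀]
        [(galRange (K := ℚ) K₀).Normal] (ηq : absoluteGaloisGroup ℚ →* ℤˣ),
        (∀ σ ∈ galRange (K := ℚ) K₀, ηq σ = 1) → ηq ≠ 1 →
      ∀ (V : WeierstrassCurve ℚ) [V.IsElliptic] [V.IsGloballyMinimal],
        V.HasGoodReductionAtPrime p → V.frobeniusTrace p = 0 →
      ∀ (κ : ZpExtension ℚ p) (γ : absoluteGaloisGroup ℚ),
        κ.IsCyclotomic → κ.IsTopGenerator γ → γ ∈ galRange (K := ℚ) K₀ →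
        IsCyclotomicVariable p γ →
      ∃ (F : Type) (_ : Field F) (_ : NumberField F) (V' : WeierstrassCurve F) (_ : V'.IsElliptic)
        (κF : ZpExtension F p) (γF : absoluteGaloisGroup F)
        (Φ : Kobayashi2003.signedSelmerInfty V' κF 1 ≃+
          Kobayashi2003.signedSelmerInfty V κ 1 × towerSignedSelmerInftyEta V κ K₀ ℚ_[p] ηq 1),
        Module.finrank ℚ F = 2 ∧ (∃ θ : F, θ ^ 2 = algebraMap ℚ F ((-1) ^ (p / 2) * p)) ∧
        (∃ C : VariableChange F, C • V.baseChange F = V') ∧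
        κF.IsCyclotomic ∧ κF.IsTopGenerator γF ∧
        (∃ ζ : ℤ_[p]ˣ, IsOfFinOrder ζ ∧
          ((GaloisRep.cyclotomicCharacter F p γF * ζ : ℤ_[p]ˣ) : ℤ_[p]) =
            (cyclotomicGenerator p : ℤ_[p])) ∧
        ∀ s : Kobayashi2003.signedSelmerInfty V' κF 1,
          ((Φ ⟨V'.conjH1 p κF.kerSubgroup γF s,
              Kobayashi2003.conjH1_mem_signedSelmerInfty V' κF 1 γF s.2⟩).1 :
              V.subgroupH1 p κ.kerSubgroup) =
            V.conjH1 p κ.kerSubgroup γ (Φ s).1 ∧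
          ((Φ ⟨V'.conjH1 p κF.kerSubgroup γF s,
              Kobayashi2003.conjH1_mem_signedSelmerInfty V' κF 1 γF s.2⟩).2 :
              V.subgroupH1 p (towerTopSubgroup κ K₀)) =
            V.conjH1 p (towerTopSubgroup κ K₀) γ (Φ s).2)
    (h74 : Kobayashi2003.thm74_etaEvenMC_iff_etaOddMC) : EtaTransportSigned :=
  etaTransportSigned_of_plus_of_thm74Fact h74 (etaTransportPlus_of_decomposition hdec)

end Summit.BirchSwinnertonDyer.BirchSwinnertonDyer.Theorems

end
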